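import Mathlib.LinearAlgebra.FiniteDimensional.Lemmas
import Mathlib.RingTheory.DiscreteValuationRing.Basic
import Literature.NumberTheory.DiophantineGeometry.FunctionFieldDivisors
import Literature.NumberTheory.DiophantineGeometry.FunctionFieldGenusApproximationProofs
import Literature.NumberTheory.DiophantineGeometry.FunctionFieldGenusRiemannRochProofs
import HarnessLib

/-!
# The residue map `L(D + P) → F_P` (Stichtenoth Lemma 1.4.8, explicit form)

For an arbitrary field extension `F/K`, a place `P` of `F/K` and a divisor `D`
(`Literature.NumberTheory.DiophantineGeometry.FunctionFieldDivisors`), this file constructs the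
`K`-linear *residue map*
`ψ : L(D + P) → F_P`, `z ↦ (z · π_P^{D(P)+1}) mod 𝔪_P`
as a definition (`PlaceOver.evalMap`), proves `Ker ψ = L(D)` (both inclusions) and the equality
case of Stichtenoth's Lemma 1.4.8: if `ψ` is surjective then `ℓ(D + P) = ℓ(D) + deg P`
(`PlaceOver.ell_add_single_eq_of_surjective`). The sibling file
`FunctionFieldGenusRiemannRochProofs` proves the *inequality* `ℓ(D + P) ≤ ℓ(D) + deg P` and the
finiteness of `L(D)` from the mere existence of such a `ψ` with `Ker ψ ⊆ L(D)`
(`exists_linearMap_residueField_ker_le`); computing `ℓ` from below (as for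
`AlgFunctionField.genus_functionField_weierstrass`) needs the explicit map, its evaluation formula
and the exact kernel, which is what is added here.

Also recorded: discreteness of a place in the iff form `v_P(t) < 1 ↔ v_P(t) ≤ v_P(π_P)`
(`PlaceOver.valuation_lt_one_iff_le`, a one-line repackaging of
`PlaceOver.valuation_le_valuation_uniformizer_of_lt_one` from `FunctionFieldGenusRiemannRochProofs`)
and the dictionary between the abstract valuation `v_P`
(values in the value group of `O_P`) and any equivalent normalised `ℤᵐ⁰`-valued valuation `u`
(`PlaceOver.valuation_le_iff_of_isEquiv`: `v_P(z) ≤ v_P(π_P)^{-n} ↔ u z ≤ exp n`), which lets one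
read the definition of `L(D)` in concrete valuations (adic valuations of a Dedekind domain,
`PlaceOver.ofPrime`; the valuation at infinity of a Weierstrass function field).

## Main definitions and results (namespace `Literature.AlgFunctionField`)

* `PlaceOver.evalMap P D : L(D + P) →ₗ[K] F_P` (Stichtenoth, proof of Lemma 1.4.8; it depends on
  the chosen uniformizer `π_P`), `PlaceOver.evalMap_apply`, `PlaceOver.evalMap_eq_zero_iff`,
  `PlaceOver.ker_evalMap` (`Ker ψ = L(D)`), `PlaceOver.kerEvalMapEquiv : Ker ψ ≃ₗ[K] L(D)`.
* `PlaceOver.ell_add_single_eq_of_surjective`: `ψ` onto ⇒ `ℓ(D + P) = ℓ(D) + deg P`.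
* `PlaceOver.valuation_lt_one_iff_le`, `PlaceOver.valuation_le_zpow_iff_of_isEquiv`,
  `PlaceOver.map_uniformizer_eq_of_isEquiv`, `PlaceOver.valuation_le_iff_of_isEquiv`,
  `degree_add_single`.

No function-field hypothesis (`IsAlgFunctionField`) is needed anywhere in this file; the one
finiteness hypothesis is an explicit instance argument.

## References

* H. Stichtenoth, *Algebraic Function Fields and Codes*, 2nd ed., GTM 254, Springer 2009, §1.4,
  Lemma 1.4.8 and its proof (the map `ψ : ℒ(A') → F_P`, `x ↦ (x t^{v_P(A')})(P)`,
  "`Ker(ψ) = ℒ(A)`"), Thm. 1.1.6 (discreteness).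
-/

noncomputable section

open WithZero

namespace Literature.NumberTheory.DiophantineGeometry.AlgFunctionField

universe u v

variable {K : Type u} {F : Type v} [Field K] [Field F] [Algebra K F]

namespace PlaceOver

/-! ### Discreteness of a place -/

/-- **Discreteness**, iff form: `v_P(t) < 1 ↔ v_P(t) ≤ v_P(π_P)` (the maximal ideal is `π_P O_P`,
Stichtenoth Thm. 1.1.6). The forward direction is
`PlaceOver.valuation_le_valuation_uniformizer_of_lt_one` (`FunctionFieldGenusRiemannRochProofs`);
the converse is `v_P(π_P) < 1`. Recorded as an `iff` for rewriting. [cite: Stichtenoth2009, Thm. 1.1.6(b)] -/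
theorem valuation_lt_one_iff_le (P : PlaceOver K F) (t : F) :
    P.valuation t < 1 ↔ P.valuation t ≤ P.valuation (P.uniformizer : F) :=
  ⟨P.valuation_le_valuation_uniformizer_of_lt_one, fun h ↦ h.trans_lt P.valuation_uniformizer_lt_one⟩

/-! ### Comparison with an equivalent concrete valuation -/

/-- If `u` is a valuation of `F` equivalent to the valuation of the place `P` (same valuation
ring), inequalities `v_P(z) ≤ v_P(t)ⁿ` may be read in `u`. [folklore] -/
theorem valuation_le_zpow_iff_of_isEquiv (P : PlaceOver K F) {Γ : Type*}
    [LinearOrderedCommGroupWithZero Γ] {u : Valuation F Γ} (hu : u.IsEquiv P.valuation)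
    (z t : F) (n : ℤ) : P.valuation z ≤ P.valuation t ^ n ↔ u z ≤ u t ^ n := by
  rw [← map_zpow₀, ← map_zpow₀]
  exact (hu z (t ^ n)).symm

/-- If `u : F → ℤᵐ⁰` is a valuation equivalent to `v_P` taking the value `exp (-1)`, then
`u(π_P) = exp (-1)` for the chosen uniformizer `π_P` (both generate the maximal ideal). [folklore] -/
theorem map_uniformizer_eq_of_isEquiv (P : PlaceOver K F) {u : Valuation F ℤᵐ⁰}
    (hu : u.IsEquiv P.valuation) (hex : ∃ t : F, u t = exp (-1)) :
    u (P.uniformizer : F) = exp (-1) := by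
  obtain ⟨t, ht⟩ := hex
  have hπ1 : u (P.uniformizer : F) < 1 := hu.lt_one_iff_lt_one.2 P.valuation_uniformizer_lt_one
  have hπ0 : u (P.uniformizer : F) ≠ 0 :=
    (Valuation.ne_zero_iff _).2 fun h ↦ P.irreducible_uniformizer.ne_zero (Subtype.ext h)
  have ht1 : P.valuation t < 1 := by
    refine hu.lt_one_iff_lt_one.1 ?_
    rw [ht, ← exp_zero, exp_lt_exp]; decide
  -- `t ∈ 𝔪_P = π_P O_P`, so `u t ≤ u π_P`
  have hle : u t ≤ u (P.uniformizer : F) := by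
    have h := P.valuation_le_valuation_uniformizer_of_lt_one ht1
    have h' := (P.valuation_le_zpow_iff_of_isEquiv hu t (P.uniformizer : F) 1)
    rw [zpow_one, zpow_one] at h'
    exact h'.1 h
  rw [ht] at hle
  obtain ⟨m, hm⟩ : ∃ m : ℤ, u (P.uniformizer : F) = exp m := ⟨_, (exp_log hπ0).symm⟩
  rw [hm] at hle hπ1 ⊢
  rw [← exp_zero, exp_lt_exp] at hπ1
  rw [exp_le_exp] at hle
  congr 1
  omega

/-- **Reading `L(D)` in a concrete valuation.** If `u : F → ℤᵐ⁰` is equivalent to `v_P` and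
normalised (`exp (-1)` is a value), the defining condition `v_P(z) ≤ v_P(π_P)^{-n}` of the
Riemann–Roch space at `P` reads `u z ≤ exp n`, i.e. `ord_P z ≥ -n`. [folklore] -/
theorem valuation_le_iff_of_isEquiv (P : PlaceOver K F) {u : Valuation F ℤᵐ⁰}
    (hu : u.IsEquiv P.valuation) (hex : ∃ t : F, u t = exp (-1)) (z : F) (n : ℤ) :
    P.valuation z ≤ P.valuation (P.uniformizer : F) ^ (-n) ↔ u z ≤ exp n := by
  rw [P.valuation_le_zpow_iff_of_isEquiv hu, P.map_uniformizer_eq_of_isEquiv hu hex, ← exp_zsmul]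
  simp

/-! ### The residue map `L(D + P) → F_P` (Stichtenoth Lemma 1.4.8) -/

/-- For `z ∈ L(D + P)`, `z · π_P^{D(P) + 1} ∈ O_P`. [cite: Stichtenoth2009, proof of Lemma 1.4.8] -/
theorem mul_uniformizer_zpow_mem (P : PlaceOver K F) (D : Divisor K F) {z : F}
    (hz : z ∈ riemannRochSpace (D + Finsupp.single P 1)) :
    z * (P.uniformizer : F) ^ (D P + 1) ∈ P.toValuationSubring := by
  rw [← P.toValuationSubring.valuation_le_one_iff]
  have h := hz P
  simp only [Finsupp.coe_add, Pi.add_apply, Finsupp.single_eq_same] at h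
  change P.valuation _ ≤ 1
  rw [map_mul, map_zpow₀]
  calc P.valuation z * P.valuation (P.uniformizer : F) ^ (D P + 1)
      ≤ P.valuation (P.uniformizer : F) ^ (-(D P + 1)) * P.valuation (P.uniformizer : F) ^ (D P + 1) :=
        mul_le_mul_left h _
    _ = 1 := by rw [← zpow_add₀ P.valuation_uniformizer_ne_zero, neg_add_cancel, zpow_zero]

/-- **The residue map** `ψ : L(D + P) → F_P`, `z ↦ (z · π_P^{D(P)+1}) mod 𝔪_P`, a `K`-linear map
(Stichtenoth, proof of Lemma 1.4.8, with `A' = D + P`, `t = π_P`, `v_P(t) = 1`,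
`x ↦ (x t^{v_P(A')}) (P)`). It depends on the chosen uniformizer `π_P`. [cite: Stichtenoth2009, Lemma 1.4.8 (proof)] -/
def evalMap (P : PlaceOver K F) (D : Divisor K F) :
    riemannRochSpace (D + Finsupp.single P 1) →ₗ[K] P.residueField where
  toFun z := IsLocalRing.residue P.toValuationSubring
    ⟨(z : F) * (P.uniformizer : F) ^ (D P + 1), P.mul_uniformizer_zpow_mem D z.2⟩
  map_add' z z' := by
    rw [← map_add]
    congr 1
    ext
    simp [add_mul]
  map_smul' c z := by
    rw [RingHom.id_apply, Algebra.smul_def, algebraMap_residueField_apply, ← map_mul]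
    congr 1
    ext
    simp only [Submodule.coe_smul, MulMemClass.coe_mul, algebraMap_toValuationSubring_apply,
      Algebra.smul_def, mul_assoc]

/-- Unfolding of `evalMap`. [folklore] -/
theorem evalMap_apply (P : PlaceOver K F) (D : Divisor K F)
    (z : riemannRochSpace (D + Finsupp.single P 1)) :
    P.evalMap D z = IsLocalRing.residue P.toValuationSubring
      ⟨(z : F) * (P.uniformizer : F) ^ (D P + 1), P.mul_uniformizer_zpow_mem D z.2⟩ :=
  rfl

/-- `L(D) ⊆ L(D + P)`. [folklore] -/
theorem riemannRochSpace_le_add_single (P : PlaceOver K F) (D : Divisor K F) :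
    riemannRochSpace D ≤ riemannRochSpace (D + Finsupp.single P 1) :=
  riemannRochSpace_mono (le_add_of_nonneg_right (Finsupp.single_nonneg.2 zero_le_one))

/-- **The kernel of the residue map is `L(D)`** (Stichtenoth, proof of Lemma 1.4.8:
`x ∈ Ker ψ ⇔ v_P(x t^{v_P(A')}) > 0 ⇔ x ∈ ℒ(A' - P)`), by discreteness of `v_P`.
[cite: Stichtenoth2009, Lemma 1.4.8 (proof)] -/
theorem evalMap_eq_zero_iff (P : PlaceOver K F) (D : Divisor K F)
    (z : riemannRochSpace (D + Finsupp.single P 1)) :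
    P.evalMap D z = 0 ↔ (z : F) ∈ riemannRochSpace D := by
  rw [evalMap_apply, IsLocalRing.residue_eq_zero_iff, ValuationSubring.valuation_lt_one_iff,
    valuation_lt_one_iff_le]
  change P.valuation ((z : F) * (P.uniformizer : F) ^ (D P + 1)) ≤ _ ↔ _
  have hπ := P.valuation_uniformizer_ne_zero
  have hsplit : P.valuation (P.uniformizer : F) =
      P.valuation (P.uniformizer : F) ^ (-(D P)) * P.valuation (P.uniformizer : F) ^ (D P + 1) := by
    rw [← zpow_add₀ hπ, show -(D P) + (D P + 1) = 1 by ring, zpow_one]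
  have key : P.valuation (z : F) ≤ P.valuation (P.uniformizer : F) ^ (-(D P)) ↔
      P.valuation ((z : F) * (P.uniformizer : F) ^ (D P + 1)) ≤ P.valuation (P.uniformizer : F) := by
    rw [← mul_le_mul_iff_left₀ (zpow_pos (zero_lt_iff.2 hπ) (D P + 1)), ← hsplit, map_mul,
      map_zpow₀]
  rw [← key]
  constructor
  · intro h Q
    by_cases hQ : Q = P
    · subst hQ; exact h
    · have h2 := z.2 Q
      simp only [Finsupp.coe_add, Pi.add_apply, Finsupp.single_eq_of_ne hQ,
        add_zero] at h2
      exact h2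
  · intro h
    exact h P

/-- The kernel of `ψ` as a submodule: `Ker ψ = L(D)` (pulled back to `L(D + P)`).
[cite: Stichtenoth2009, Lemma 1.4.8 (proof)] -/
theorem ker_evalMap (P : PlaceOver K F) (D : Divisor K F) :
    LinearMap.ker (P.evalMap D) =
      (riemannRochSpace D).comap (riemannRochSpace (D + Finsupp.single P 1)).subtype := by
  ext z
  rw [LinearMap.mem_ker, evalMap_eq_zero_iff, Submodule.mem_comap, Submodule.subtype_apply]

/-- `Ker ψ ≃ L(D)` as `K`-spaces. [cite: Stichtenoth2009, Lemma 1.4.8 (proof)] -/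
def kerEvalMapEquiv (P : PlaceOver K F) (D : Divisor K F) :
    LinearMap.ker (P.evalMap D) ≃ₗ[K] riemannRochSpace D :=
  (LinearEquiv.ofEq _ _ (P.ker_evalMap D)).trans
    (Submodule.comapSubtypeEquivOfLe (P.riemannRochSpace_le_add_single D))

/-- **The equality case of Stichtenoth's Lemma 1.4.8**: if the residue map
`ψ : L(D + P) → F_P` is surjective (and `L(D + P)` is finite-dimensional), then
`ℓ(D + P) = ℓ(D) + deg P` (rank–nullity for `ψ` with `Ker ψ = L(D)`, `Im ψ = F_P`). The
inequality `ℓ(D + P) ≤ ℓ(D) + deg P` for function fields is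
`AlgFunctionField.ell_add_single_le` (`FunctionFieldGenusRiemannRochProofs`); this equality
case, which needs the explicit map and `Ker ψ = L(D)`, is what computes `ℓ` from below.
[cite: Stichtenoth2009, Lemma 1.4.8 (proof)] -/
theorem ell_add_single_eq_of_surjective (P : PlaceOver K F) (D : Divisor K F)
    [FiniteDimensional K (riemannRochSpace (D + Finsupp.single P 1))]
    (h : Function.Surjective (P.evalMap D)) :
    ell (D + Finsupp.single P 1) = ell D + P.degree := by
  unfold ell degree
  rw [← (P.evalMap D).finrank_range_add_finrank_ker, (P.kerEvalMapEquiv D).finrank_eq, add_comm,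
    LinearMap.range_eq_top.2 h, finrank_top]

end PlaceOver

/-- `deg (D + P) = deg D + deg P`. [folklore] -/
theorem degree_add_single (D : Divisor K F) (P : PlaceOver K F) :
    (D + Finsupp.single P 1).degree = D.degree + P.degree := by
  rw [map_add, Divisor.degree_single, one_mul]

end Literature.NumberTheory.DiophantineGeometry.AlgFunctionField
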